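import Summits.CriticalPhenomena.PercolationContinuityZ3.Theorems.Transplant.SkelNegParamsLatticeInv
import Summits.CriticalPhenomena.PercolationContinuityZ3.Theorems.Transplant.SkelPhiCellsWeakG
import HarnessLib

/-!
# N1 params, part 0e (q-free arithmetic, consumer-independent): THE FINE WINDOW MAP OF RECORD — `Skelφ.NegPrm.fine φ t P n h ℓ v_α`, the fine cell-aligned
# skeleton `fineSkel` of the long cell lattice `[800·u 800·v]` read with the TWO-UNIT cells `P = ⟨K, m⟩` ((R3) of record: resolution `c_i := 20·K·m_i` fine units per
# lattice cell on axis `i`, nearest-cell rounding), and its five facts for ANY planar map `φ`: base point, 1-Lipschitz, WEAK STEPS, kit drift reads `≤ s` fine units,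
# and the inverse reading (a fine box is a φ-box)

builds on p205010 (kernel theorem, internal audit signed; external expert review pending) — nothing in this file uses p205010; NOTHING is claimed about
the node `SamePDropOfSkeletonNeg₁` (OPEN).
Status sentence (coordinator 2026-08-20T04:30Z): "θ(p_c) = 0 on ℤ^d, all d ≥ 2 — kernel-verified (Lean 4/Mathlib, standard axioms); internal adversarial
audit SIGNED 2026-08-20 04:29Z; external expert review pending."
Lane `prim-bschramm-*`, seat `prim-bschramm-stmt` (gen 13); helper file (`--supports stmt-CriticalPhenomena-4575 --as helper`); ledger HOME/prim-bschramm-stmt/NEG-PARAMS.md v0.8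
(n1) cells of record `⟨Kcell, m⟩` over `fineSkel` (p3 ruling (3) 2026-08-21T13:19:49Z), (n8), (n10).
DESIGN: the planar map `φ` is an explicit argument (NOT `Φ.φ`), so the same definition serves the skeleton and its transpose (`Skelφ.trφ`, (L0-5) orientation) and
every fact takes exactly the hypotheses it uses (`Lip G φ` / `Steps G φ` / the two resolution inequalities `c_i·L_i ≤ D`); the cells `P : PCells2` are an explicit argument,
so the map and the cells share `K` and `m_i = P.s i` with zero glue (`c_i = 20·P.K·P.s i = 20·P.r i`: one lattice cell = one planar cell of `PlanarCells2*`).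
INPUTS: hp-8 g33's `Skelφ.fineSkel/lip_fineSkel/fine_containment` (TwoAxisParaCellsFine p276618 ✓), `Skelφ.WeakSteps/weakSteps_fineSkel` (SkelPhiCellsWeakG p278428 ✓); hp-8 g31's
`TwoAxis.Para.coarse/lam0/lam1/mul_lam_eq` (TwoAxisParaCells p266166 ✓); stmt's `NegPrm.vβOf/Dof/coarse` (SkelNegParamsLattice p272834 ✓), `mul_abs_sub_lt_of_coarse` (LatticeInv p274889 ✓),
`abs_vβ_le` (SkelNegParamsCoarse p267342 ✓).  The O-level instantiation (`Neg.fine κ Φ t p D f := NegPrm.fine (oriented Φ.φ) t (Neg.cellsF …) n_L h_L ℓ_L v_L`, hypotheses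
discharged by `Neg.cL_le_D_at` p277618 ✓) follows in `SkelNeg1ParamsF` once the Step I″-O record shape is fixed (p3).
* §1 `TwoAxis.Para.abs_sub_le_of_fine` — the inverse rounding with ONE RESOLUTION PER AXIS: `|Δ fine_i| ≤ r` (both i), `c ≤ c₀, c₁` ⇒ `c·|Δx₀| ≤ |A|(|n|+|v_α|)(r+1)`,
  `c·|Δx₁| ≤ |A|(|h|+|v_β|)(r+1)`;
* §2 **`NegPrm.fine φ t P n h ℓ v_α`**, `fine_apply`, `fine_unit_eq_coarse` (the `m = 1` reading IS `NegPrm.coarse`), `c_nonneg/twentyK_le_c`;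
* §3 **`fine_base`** (`fine … t = 0`: the `hψ0` of `sepGeomSG₂`), **`lip_fine`**, **`weakSteps_fine`** (the `hlip/hws` of `sepGeomSG₂/stepsGeomSG₂/levelGeomSG₂`), **`fine_drift_le`**
  (`|Δφ|_∞ ≤ s ⇒ |Δ fine|_∞ ≤ s`: a kit of planar size `R′` reads as `≤ R′` fine units, inside one stub increment `m_i ≥ R′ + 1`), **`φ_extent_of_fine_extent`**
  (`|Δ fine|_∞ ≤ r ⇒ K·|Δφ_i| ≤ 80(n + ℓ + 3|h| + 1)(r+1)`, the schedule's `rmaxφ` conversion, same constant as the coarse map).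
[cite: MartineauTassion2017, §4.1–4.3 (the cell lattice generated by u and v)] [cite: KozmaNitzan2024, §4 pp. 25–26 (two-unit cells), Lemma 10 Step IV (siting by planar position)]
-/

namespace Summit.CriticalPhenomena.PercolationContinuityZ3.Theorems.Transplant

open Literature.Probability.LatticeModels

/-! ## §1 The inverse rounding with one resolution per axis -/

namespace TwoAxis.Para

/-- **Inverse reading of a fine position** (resolutions `c₀, c₁ ≥ c ≥ 0`, offsets arbitrary, `D = det > 0`): if the two fine coordinates of `x, x'` differ by at most `r`
then `c·|x₀ − x'₀| ≤ |A|·(|n| + |v_α|)·(r+1)` and `c·|x₁ − x'₁| ≤ |A|·(|h| + |v_β|)·(r+1)` (from `M·λ = D·x`). [folklore] -/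
theorem abs_sub_le_of_fine {A n h vα vβ c c₀ c₁ s₀ s₁ r : ℤ} (hc : 0 ≤ c) (hc₀ : c ≤ c₀) (hc₁ : c ≤ c₁) (hD : 0 < detD A n h vα vβ) {x x' : Site 2}
    (h0 : |coarse c₀ s₀ (detD A n h vα vβ) (lam0 A vα vβ x) - coarse c₀ s₀ (detD A n h vα vβ) (lam0 A vα vβ x')| ≤ r)
    (h1 : |coarse c₁ s₁ (detD A n h vα vβ) (lam1 A n h x) - coarse c₁ s₁ (detD A n h vα vβ) (lam1 A n h x')| ≤ r) :
    c * |x 0 - x' 0| ≤ |A| * (|n| + |vα|) * (r + 1) ∧ c * |x 1 - x' 1| ≤ |A| * (|h| + |vβ|) * (r + 1) := by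
  set D := detD A n h vα vβ with hDdef
  set d0 := lam0 A vα vβ x - lam0 A vα vβ x' with hd0
  set d1 := lam1 A n h x - lam1 A n h x' with hd1
  have e0 := mul_abs_sub_lt_of_coarse (hc.trans hc₀) hD h0
  have e1 := mul_abs_sub_lt_of_coarse (hc.trans hc₁) hD h1
  have f0 : c * |d0| ≤ (r + 1) * D := (mul_le_mul_of_nonneg_right hc₀ (abs_nonneg _)).trans e0.le
  have f1 : c * |d1| ≤ (r + 1) * D := (mul_le_mul_of_nonneg_right hc₁ (abs_nonneg _)).trans e1.le
  have hm := mul_lam_eq A n h vα vβ x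
  have hm' := mul_lam_eq A n h vα vβ x'
  have hx0 : D * (x 0 - x' 0) = A * (n * d0 + vα * d1) := by rw [hd0, hd1, hDdef]; linear_combination hm'.1 - hm.1
  have hx1 : D * (x 1 - x' 1) = A * (h * d0 + vβ * d1) := by rw [hd0, hd1, hDdef]; linear_combination hm'.2 - hm.2
  have hA := abs_nonneg A
  constructor
  · have a1 : D * |x 0 - x' 0| = |A| * |n * d0 + vα * d1| := by
      have e : |D * (x 0 - x' 0)| = |A * (n * d0 + vα * d1)| := by rw [hx0]
      rwa [abs_mul, abs_mul, abs_of_pos hD] at e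
    have t : |n * d0 + vα * d1| ≤ |n| * |d0| + |vα| * |d1| := by
      calc |n * d0 + vα * d1| ≤ |n * d0| + |vα * d1| := abs_add_le _ _
        _ = |n| * |d0| + |vα| * |d1| := by rw [abs_mul, abs_mul]
    have key : D * (c * |x 0 - x' 0|) ≤ D * (|A| * (|n| + |vα|) * (r + 1)) := by
      calc D * (c * |x 0 - x' 0|) = c * (D * |x 0 - x' 0|) := by ring
        _ = c * (|A| * |n * d0 + vα * d1|) := by rw [a1]
        _ ≤ c * (|A| * (|n| * |d0| + |vα| * |d1|)) := by gcongr
        _ = |A| * (|n| * (c * |d0|) + |vα| * (c * |d1|)) := by ring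
        _ ≤ |A| * (|n| * ((r + 1) * D) + |vα| * ((r + 1) * D)) := by gcongr
        _ = D * (|A| * (|n| + |vα|) * (r + 1)) := by ring
    exact le_of_mul_le_mul_left key hD
  · have a1 : D * |x 1 - x' 1| = |A| * |h * d0 + vβ * d1| := by
      have e : |D * (x 1 - x' 1)| = |A * (h * d0 + vβ * d1)| := by rw [hx1]
      rwa [abs_mul, abs_mul, abs_of_pos hD] at e
    have t : |h * d0 + vβ * d1| ≤ |h| * |d0| + |vβ| * |d1| := by
      calc |h * d0 + vβ * d1| ≤ |h * d0| + |vβ * d1| := abs_add_le _ _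
        _ = |h| * |d0| + |vβ| * |d1| := by rw [abs_mul, abs_mul]
    have key : D * (c * |x 1 - x' 1|) ≤ D * (|A| * (|h| + |vβ|) * (r + 1)) := by
      calc D * (c * |x 1 - x' 1|) = c * (D * |x 1 - x' 1|) := by ring
        _ = c * (|A| * |h * d0 + vβ * d1|) := by rw [a1]
        _ ≤ c * (|A| * (|h| * |d0| + |vβ| * |d1|)) := by gcongr
        _ = |A| * (|h| * (c * |d0|) + |vβ| * (c * |d1|)) := by ring
        _ ≤ |A| * (|h| * ((r + 1) * D) + |vβ| * ((r + 1) * D)) := by gcongr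
        _ = D * (|A| * (|h| + |vβ|) * (r + 1)) := by ring
    exact le_of_mul_le_mul_left key hD

end TwoAxis.Para

namespace Skelφ

namespace NegPrm

open TwoAxis.Para (lam0 lam1)

variable {V : Type} {G : SimpleGraph V}

/-! ## §2 The fine window map of record -/

/-- **THE FINE WINDOW MAP OF N1** (the window map of the two-unit cells `P = ⟨K, m⟩`, NEG-PARAMS (n1) (R3) of record): the fine cell-aligned skeleton of the long
cell lattice `[800·u 800·v]` (`u = (n, h)`, `v = (v_α, v_β)`, `v_β := vβOf n h ℓ v_α`, `D := Dof n h ℓ v_α`) with resolution `c_i := 20·K·m_i` fine units per lattice cell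
on axis `i` (`m_i = P.s i`; one lattice cell = `20·P.r i` fine units = one planar cell of `PlanarCells2*`) and nearest-cell rounding (offsets `D/2`):
`fine φ t P n h ℓ v_α := fineSkel φ t 800 n h v_α v_β (20·K·m₀) (20·K·m₁) (D/2) (D/2) D`. [this work] -/
def fine (φ : V → Site 2) (t : V) (P : PCells2) (n : ℕ) (h : ℤ) (ℓ : ℕ) (vα : ℤ) : V → Site 2 :=
  fineSkel φ t 800 n h vα (vβOf n h ℓ vα) (20 * (P.K : ℤ) * (P.s 0 : ℤ)) (20 * (P.K : ℤ) * (P.s 1 : ℤ))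
    (Dof n h ℓ vα / 2) (Dof n h ℓ vα / 2) (Dof n h ℓ vα)

/-- `fine` unfolded. [folklore] -/
theorem fine_eq (φ : V → Site 2) (t : V) (P : PCells2) (n : ℕ) (h : ℤ) (ℓ : ℕ) (vα : ℤ) :
    fine φ t P n h ℓ vα = fineSkel φ t 800 n h vα (vβOf n h ℓ vα) (20 * (P.K : ℤ) * (P.s 0 : ℤ)) (20 * (P.K : ℤ) * (P.s 1 : ℤ))
      (Dof n h ℓ vα / 2) (Dof n h ℓ vα / 2) (Dof n h ℓ vα) := rfl

/-- The two fine coordinates: `fine_i = ⌊(c_i·λ_i + D/2)/D⌋` of the relative position. [folklore] -/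
theorem fine_apply (φ : V → Site 2) (t : V) (P : PCells2) (n : ℕ) (h : ℤ) (ℓ : ℕ) (vα : ℤ) (w : V) :
    fine φ t P n h ℓ vα w 0 =
        TwoAxis.Para.coarse (20 * (P.K : ℤ) * (P.s 0 : ℤ)) (Dof n h ℓ vα / 2) (Dof n h ℓ vα) (lam0 800 vα (vβOf n h ℓ vα) (relφ φ t w)) ∧
      fine φ t P n h ℓ vα w 1 =
        TwoAxis.Para.coarse (20 * (P.K : ℤ) * (P.s 1 : ℤ)) (Dof n h ℓ vα / 2) (Dof n h ℓ vα) (lam1 800 n h (relφ φ t w)) :=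
  ⟨rfl, rfl⟩

/-- **The `m = 1` reading is the coarse map**: for unit stub increments, `fine φ t P = coarse φ t P.K` (so `NegPrm.coarse`, p272834, is the diagonal case).
[folklore] -/
theorem fine_unit_eq_coarse (φ : V → Site 2) (t : V) (P : PCells2) (hs : ∀ i, P.s i = 1) (n : ℕ) (h : ℤ) (ℓ : ℕ) (vα : ℤ) :
    fine φ t P n h ℓ vα = coarse φ t P.K n h ℓ vα := by
  rw [fine_eq, coarse_eq, coarseSkel_eq_fineSkel, hs 0, hs 1]
  push_cast
  rw [mul_one]

/-- The resolutions are nonnegative: `0 ≤ 20·K·m_i`. [folklore] -/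
theorem c_nonneg (P : PCells2) (i : Fin 2) : (0 : ℤ) ≤ 20 * (P.K : ℤ) * (P.s i : ℤ) := by positivity

/-- The resolutions dominate the coarse resolution: `20·K ≤ 20·K·m_i` (`1 ≤ m_i`). [folklore] -/
theorem twentyK_le_c (P : PCells2) (i : Fin 2) : 20 * (P.K : ℤ) ≤ 20 * (P.K : ℤ) * (P.s i : ℤ) := by
  have hs : (1 : ℤ) ≤ (P.s i : ℤ) := by exact_mod_cast P.hs i
  have hK : (0 : ℤ) ≤ 20 * (P.K : ℤ) := by positivity
  nlinarith

/-- The resolution of axis `i` is `20·r_i` (one lattice cell = one planar cell of `P`). [folklore] -/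
theorem c_eq_twenty_mul_r (P : PCells2) (i : Fin 2) : 20 * (P.K : ℤ) * (P.s i : ℤ) = 20 * (P.r i : ℤ) := by
  rw [P.r_eq]; ring

/-! ## §3 The five facts -/

/-- **BASE POINT**: the base vertex `t` has fine position `0` (`1 ≤ n`, `1 ≤ ℓ`, so `D > 0` and `⌊(D/2)/D⌋ = 0`) — the hypothesis `hψ0 : ψ w₀ = 0` of `sepGeomSG₂` at
`w₀ = t`. [folklore] -/
theorem fine_base (φ : V → Site 2) (t : V) (P : PCells2) {n ℓ : ℕ} (hn : 1 ≤ n) (hℓ : 1 ≤ ℓ) (h vα : ℤ) : fine φ t P n h ℓ vα t = 0 := by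
  have hD := Dof_pos hn hℓ h vα
  have hrel : relφ φ t t = 0 := by funext i; simp
  have h0 : ∀ c : ℤ, TwoAxis.Para.coarse c (Dof n h ℓ vα / 2) (Dof n h ℓ vα) 0 = 0 := by
    intro c
    unfold TwoAxis.Para.coarse
    rw [mul_zero, zero_add]
    refine Int.ediv_eq_zero_of_lt (Int.ediv_nonneg hD.le (by norm_num)) ?_
    rw [Int.ediv_lt_iff_lt_mul (by norm_num : (0 : ℤ) < 2)]
    linarith
  have hl0 : lam0 800 vα (vβOf n h ℓ vα) 0 = 0 := by simp [TwoAxis.Para.lam0]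
  have hl1 : lam1 800 (n : ℤ) h 0 = 0 := by simp [TwoAxis.Para.lam1, TwoAxis.Para.bp]
  funext i
  fin_cases i
  · show fine φ t P n h ℓ vα t 0 = 0
    rw [(fine_apply φ t P n h ℓ vα t).1, hrel, hl0, h0]
  · show fine φ t P n h ℓ vα t 1 = 0
    rw [(fine_apply φ t P n h ℓ vα t).2, hrel, hl1, h0]

/-- **THE FINE MAP IS 1-LIPSCHITZ** from the two resolution inequalities `c_i·L_i ≤ D` (`c₀·|800|·(|v_β| + |v_α|) ≤ D`, `c₁·|800|·(|n| + |h|) ≤ D` — true by the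
choice `m_i := ⌊D/(20K·L_i)⌋`, `NegPrm.cL_le_D₀/₁`, at the ledger's values `Neg.cL_le_D_at`) — the `hlip` of `sepGeomSG₂`/`stepsGeomSG₂`/`levelGeomSG₂` and of
the window spans. [cite: MartineauTassion2017, §4.3] -/
theorem lip_fine {φ : V → Site 2} (hlip : Lip G φ) (t : V) (P : PCells2) {n ℓ : ℕ} (hn : 1 ≤ n) (hℓ : 1 ≤ ℓ) {h vα : ℤ}
    (hL0 : 20 * (P.K : ℤ) * (P.s 0 : ℤ) * (|(800 : ℤ)| * (|vβOf n h ℓ vα| + |vα|)) ≤ Dof n h ℓ vα)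
    (hL1 : 20 * (P.K : ℤ) * (P.s 1 : ℤ) * (|(800 : ℤ)| * (|(n : ℤ)| + |h|)) ≤ Dof n h ℓ vα) :
    Lip G (fine φ t P n h ℓ vα) := by
  rw [fine_eq]
  exact lip_fineSkel hlip t (c_nonneg P 0) (c_nonneg P 1) (Dof_pos hn hℓ h vα) hL0 hL1

/-- **THE FINE MAP HAS WEAK STEPS** from unit steps of `φ` alone (`1 ≤ n`, `1 ≤ ℓ`; hp-8's `weakSteps_fineSkel`: floors are monotone) — the `hws` of
`sepGeomSG₂`/`stepsGeomSG₂`. [this work] -/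
theorem weakSteps_fine {φ : V → Site 2} (hstep : Steps G φ) (t : V) (P : PCells2) {n ℓ : ℕ} (hn : 1 ≤ n) (hℓ : 1 ≤ ℓ) (h vα : ℤ) :
    WeakSteps G (fine φ t P n h ℓ vα) := by
  rw [fine_eq]
  exact weakSteps_fineSkel hstep t (Dof_pos hn hℓ h vα) (c_nonneg P 0) (c_nonneg P 1)

/-- **KIT DRIFT READS AS AT MOST `s` FINE UNITS**: two vertices at planar distance `≤ s` in each coordinate have fine positions at distance `≤ s` in each
coordinate, from the two resolution inequalities alone (`c_i·L_i·s ≤ s·D`) — so a kit of planar size `R′` stays inside one stub increment `m_i ≥ R′ + 1`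
(`Neg.R'_le_m_at`). [cite: KozmaNitzan2024, §4 Lemma 10 Step IV] -/
theorem fine_drift_le (t : V) (P : PCells2) {n ℓ : ℕ} (hn : 1 ≤ n) (hℓ : 1 ≤ ℓ) {h vα : ℤ}
    (hL0 : 20 * (P.K : ℤ) * (P.s 0 : ℤ) * (|(800 : ℤ)| * (|vβOf n h ℓ vα| + |vα|)) ≤ Dof n h ℓ vα)
    (hL1 : 20 * (P.K : ℤ) * (P.s 1 : ℤ) * (|(800 : ℤ)| * (|(n : ℤ)| + |h|)) ≤ Dof n h ℓ vα) {s : ℤ} (hs : 0 ≤ s) {φ : V → Site 2} {w w' : V}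
    (h0 : |φ w 0 - φ w' 0| ≤ s) (h1 : |φ w 1 - φ w' 1| ≤ s) (i : Fin 2) :
    |fine φ t P n h ℓ vα w i - fine φ t P n h ℓ vα w' i| ≤ s := by
  have hD := Dof_pos hn hℓ h vα
  have hL0' : 20 * (P.K : ℤ) * (P.s 0 : ℤ) * (|(800 : ℤ)| * (|vβOf n h ℓ vα| + |vα|) * s) ≤ s * Dof n h ℓ vα := by
    calc 20 * (P.K : ℤ) * (P.s 0 : ℤ) * (|(800 : ℤ)| * (|vβOf n h ℓ vα| + |vα|) * s)
        = 20 * (P.K : ℤ) * (P.s 0 : ℤ) * (|(800 : ℤ)| * (|vβOf n h ℓ vα| + |vα|)) * s := by ring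
      _ ≤ Dof n h ℓ vα * s := mul_le_mul_of_nonneg_right hL0 hs
      _ = s * Dof n h ℓ vα := mul_comm _ _
  have hL1' : 20 * (P.K : ℤ) * (P.s 1 : ℤ) * (|(800 : ℤ)| * (|(n : ℤ)| + |h|) * s) ≤ s * Dof n h ℓ vα := by
    calc 20 * (P.K : ℤ) * (P.s 1 : ℤ) * (|(800 : ℤ)| * (|(n : ℤ)| + |h|) * s)
        = 20 * (P.K : ℤ) * (P.s 1 : ℤ) * (|(800 : ℤ)| * (|(n : ℤ)| + |h|)) * s := by ring
      _ ≤ Dof n h ℓ vα * s := mul_le_mul_of_nonneg_right hL1 hs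
      _ = s * Dof n h ℓ vα := mul_comm _ _
  have key := fine_containment (φ := φ) t (s₀ := Dof n h ℓ vα / 2) (s₁ := Dof n h ℓ vα / 2) hD (c_nonneg P 0) (c_nonneg P 1) hL0' hL1' h0 h1
  rw [fine_eq]
  fin_cases i
  · exact key.1
  · exact key.2

/-- **A FINE BOX IS A φ-BOX**: if two vertices have fine positions at distance `≤ r` in each coordinate then `K·|Δφ_i| ≤ 80·(n + ℓ + 3|h| + 1)·(r + 1)` for both planar
coordinates (`1 ≤ n`, `1 ≤ ℓ`, `|v_α| ≤ n`; the resolutions are `≥ 20K`, so the coarse map's constant stands: `φ_extent_of_coarse_extent`) — the planar size of a fine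
window of radius `r`, for the schedule's `rmaxφ` and the Φ2 / fat-radius / excess-radius conversions. [cite: KozmaNitzan2024, §4 Lemma 12 (p. 24: the planar size of a window)] -/
theorem φ_extent_of_fine_extent {φ : V → Site 2} (t : V) (P : PCells2) {n ℓ : ℕ} (hn : 1 ≤ n) (hℓ : 1 ≤ ℓ) (h : ℤ) {vα : ℤ} (hv : |vα| ≤ (n : ℤ))
    {w w' : V} {r : ℤ} (hr : 0 ≤ r) (hρ : ∀ i, |fine φ t P n h ℓ vα w i - fine φ t P n h ℓ vα w' i| ≤ r) (i : Fin 2) :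
    (P.K : ℤ) * |φ w i - φ w' i| ≤ 80 * ((n : ℤ) + ℓ + 3 * |h| + 1) * (r + 1) := by
  have hD : 0 < Dof n h ℓ vα := Dof_pos hn hℓ h vα
  have hvβ : |vβOf n h ℓ vα| ≤ (ℓ : ℤ) + 2 * |h| + 1 :=
    abs_vβ_le (by exact_mod_cast hn) (by positivity) hv (modulus_vβOf_layer hn h ℓ vα)
  have h0 := hρ 0
  have h1 := hρ 1
  rw [(fine_apply φ t P n h ℓ vα w).1, (fine_apply φ t P n h ℓ vα w').1] at h0
  rw [(fine_apply φ t P n h ℓ vα w).2, (fine_apply φ t P n h ℓ vα w').2] at h1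
  have hc : (0 : ℤ) ≤ 20 * (P.K : ℤ) := by positivity
  obtain ⟨e0, e1⟩ := TwoAxis.Para.abs_sub_le_of_fine (A := 800) (n := (n : ℤ)) (h := h) (vα := vα) (vβ := vβOf n h ℓ vα) hc
    (twentyK_le_c P 0) (twentyK_le_c P 1) hD h0 h1
  have hx0 : relφ φ t w 0 - relφ φ t w' 0 = φ w 0 - φ w' 0 := by simp
  have hx1 : relφ φ t w 1 - relφ φ t w' 1 = φ w 1 - φ w' 1 := by simp
  rw [hx0] at e0
  rw [hx1] at e1
  have e8 : |(800 : ℤ)| = 800 := abs_of_nonneg (by norm_num)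
  have en : |(n : ℤ)| = n := abs_of_nonneg (by positivity)
  rw [e8, en] at e0
  rw [e8] at e1
  fin_cases i
  · have hφ := abs_nonneg (φ w 0 - φ w' 0)
    show (P.K : ℤ) * |φ w 0 - φ w' 0| ≤ 80 * ((n : ℤ) + ℓ + 3 * |h| + 1) * (r + 1)
    nlinarith [hv, abs_nonneg vα, abs_nonneg h, hφ, mul_nonneg hφ hr]
  · have hφ := abs_nonneg (φ w 1 - φ w' 1)
    show (P.K : ℤ) * |φ w 1 - φ w' 1| ≤ 80 * ((n : ℤ) + ℓ + 3 * |h| + 1) * (r + 1)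
    nlinarith [hvβ, abs_nonneg (vβOf n h ℓ vα), abs_nonneg h, hφ, mul_nonneg hφ hr]

end NegPrm

end Skelφ

end Summit.CriticalPhenomena.PercolationContinuityZ3.Theorems.Transplant
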